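import Summits.MatrixMultiplication.OmegaCensus.DominoUniformZ4Z4
import HarnessLib

/-!
# The two regimes of the uniform domino theorem over `A ↠ ℤ₄ × ℤ₄`: which character pair kills which size

ω-census `pub-omega`, family (b3), seat pub-omega-group gen 16.  Framing: lottery ticket; floor = certified bounds/negative
ranges.  VALUE: a stated reading (pure arithmetic, kernel-checked) of the proof of `no_shifted_form_of_onto_z4z4`
(`DominoUniformZ4Z4.lean`), explaining the empirical pattern of gens 15–16's tables and of kit j185289 (prereg P-013:
`d ≡ 3, 5 (mod 8)` ⇒ the pair `w, w+2w'` kills every configuration; `d ≡ 1, 7 (mod 8)` ⇒ the pair `w', w'+2w` does);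
NOT progress on ω.

Notation (as in the uniform proof): `c_ee, c_eo, c_oe, c_oo` = numbers of points of `X` in the four parity classes of the
coordinates `(m, n)` (dual to `(φβ, φγ)`); `d = |X|` their sum; the three real characters give
`c_ee + c_eo − c_oe − c_oo = ±1`, `c_ee − c_eo + c_oe − c_oo = ±1`, `c_ee − c_eo − c_oe + c_oo = ±1` (R).
* `class_parities_three_one`: under (R) exactly one or exactly three of the four counts are odd, and
  three are odd iff `d ≡ 3, 5 (mod 8)`, one is odd iff `d ≡ 1, 7 (mod 8)`.
* `pair_w_kills_three_odd`: the congruences of the pair `w, w+2w'` (`x₁+x₂ ≡ 2c_ee`, `y₁+y₂ ≡ 2c_oe`, `x₁−x₂ ≡ 2c_eo`,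
  `y₁−y₂ ≡ 2c_oo (mod 4)`) together with the Pell conclusions `kP_mod_four` for both characters (`xᵢ ≡ 0 ∨ yᵢ ≡ 0 (mod 4)`)
  are contradictory when three counts are odd — i.e. for `d ≡ 3, 5 (mod 8)` the pair `w, w+2w'` alone kills.
* `pair_w'_kills_one_odd`: the pair `w', w'+2w` (`kPp_mod_four`, `kPm_mod_four`) alone kills when one count is odd —
  `d ≡ 1, 7 (mod 8)`.
So P-013's five cells (`d = 15, 17, 19, 21, 23`) and the tables for `d = 5, 7, 9, 11, 13` are instances of these two lemmas.
-/

namespace Summit.MatrixMultiplication.OmegaCensus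

/-- **Class-count parities.**  Under the three real-character equations, the number of odd counts among
`c_ee, c_eo, c_oe, c_oo` is `1` or `3`; it is `3` iff `d ≡ 3, 5 (mod 8)` and `1` iff `d ≡ 1, 7 (mod 8)` (`d` = their sum).
[folklore] -/
theorem class_parities_three_one (cEE cEO cOE cOO : ℕ)
    (hR1 : (cEE : ℤ) + cEO - cOE - cOO = 1 ∨ (cEE : ℤ) + cEO - cOE - cOO = -1)
    (hR2 : (cEE : ℤ) - cEO + cOE - cOO = 1 ∨ (cEE : ℤ) - cEO + cOE - cOO = -1)
    (hR3 : (cEE : ℤ) - cEO - cOE + cOO = 1 ∨ (cEE : ℤ) - cEO - cOE + cOO = -1) :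
    (cEE % 2 + cEO % 2 + cOE % 2 + cOO % 2 = 1 ∨ cEE % 2 + cEO % 2 + cOE % 2 + cOO % 2 = 3) ∧
    (cEE % 2 + cEO % 2 + cOE % 2 + cOO % 2 = 3 ↔
      ((cEE + cEO + cOE + cOO) % 8 = 3 ∨ (cEE + cEO + cOE + cOO) % 8 = 5)) ∧
    (cEE % 2 + cEO % 2 + cOE % 2 + cOO % 2 = 1 ↔
      ((cEE + cEO + cOE + cOO) % 8 = 1 ∨ (cEE + cEO + cOE + cOO) % 8 = 7)) := by
  omega

/-- **The pair `w, w + 2w'` kills the regime 'three counts odd' (`d ≡ 3, 5 (mod 8)`).**  Inputs: the four congruences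
of the pair (`congr_L1`–`congr_L4`) and the Pell conclusions `kP_mod_four` for `a_w = (x₁, y₁)` and `a_{w+2w'} = (x₂, y₂)`;
the real-character equations are not even needed. [folklore] -/
theorem pair_w_kills_three_odd (cEE cEO cOE cOO : ℕ) (x₁ y₁ x₂ y₂ : ℤ)
    (hC1 : (x₁ + x₂) % 4 = 2 * (cEE : ℤ) % 4) (hC2 : (y₁ + y₂) % 4 = 2 * (cOE : ℤ) % 4)
    (hC3 : (x₁ - x₂) % 4 = 2 * (cEO : ℤ) % 4) (hC4 : (y₁ - y₂) % 4 = 2 * (cOO : ℤ) % 4)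
    (hK1 : x₁ % 4 = 0 ∨ y₁ % 4 = 0) (hK2 : x₂ % 4 = 0 ∨ y₂ % 4 = 0)
    (hodd : cEE % 2 + cEO % 2 + cOE % 2 + cOO % 2 = 3) : False := by
  omega

/-- **The pair `w', w' + 2w` kills the regime 'one count odd' (`d ≡ 1, 7 (mod 8)`).**  Inputs: the congruences
`congr_L5`–`congr_L8` and the Pell conclusions `kPp_mod_four` for `a_{w'} = (x₁, y₁)`, `kPm_mod_four` for
`a_{w'+2w} = (x₂, y₂)`. [folklore] -/
theorem pair_w'_kills_one_odd (cEE cEO cOE cOO : ℕ) (x₁ y₁ x₂ y₂ : ℤ)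
    (hC5 : (x₁ + x₂) % 4 = 2 * (cEE : ℤ) % 4) (hC6 : (y₁ + y₂) % 4 = 2 * (cEO : ℤ) % 4)
    (hC7 : (x₁ - x₂) % 4 = 2 * (cOE : ℤ) % 4) (hC8 : (y₁ - y₂) % 4 = 2 * (cOO : ℤ) % 4)
    (hK3 : x₁ % 4 = 0 ∨ y₁ % 4 = 2) (hK4 : y₂ % 4 = 0 ∨ x₂ % 4 = 2)
    (hodd : cEE % 2 + cEO % 2 + cOE % 2 + cOO % 2 = 1) : False := by
  omega

end Summit.MatrixMultiplication.OmegaCensus
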